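import Summits.HubbardSuperconductivity.HubbardSuperconductivity.Theorems.NodalWardXYDefs

/-!
# `PerturbedXYOrder` (stmt-HubbardSuperconductivity-10739) — line `schwarz-inheritance`, stub `stub_reflectionOddReal`

Reflection-odd purely imaginary kernels have a REAL perturbed partition function `Z_K` and a REAL
magnetisation numerator `num_K`.

Let `R x = (−x₀, x₁, x₂)` be the reflection of the torus `(ℤ/Lℤ)³` (`Function.update x 0 (-x 0)`,
written out explicitly below — no new definition is introduced) and `Φ θ = θ ∘ R` the induced
coordinate permutation of angle configurations. Then
* `Φ` preserves Lebesgue measure and the cube `[0, 2π]^Λ` (`ro_setIntegral_comp_R`, from Mathlib's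
  `volume_preserving_arrowCongr'` and `MeasurePreserving.setIntegral_preimage_emb`);
* the ferromagnetic weight is invariant, `w_J ∘ Φ = w_J`: the bond sum `Σ_{(x,i)} cos(θ_{R(x+e_i)} − θ_{Rx})`
  is re-indexed by `x ↦ Rx − e₀` on direction `0` (using `R(x + e₀) = Rx − e₀` and evenness of `cos`)
  and by `x ↦ Rx` on directions `i ≠ 0` (`R(x + e_i) = Rx + e_i`) (`ro_bondSum_comp_R`);
* hence, if `W_K ∘ Φ = −W_K`, the change of variables gives `Z_K = ∫ w_J e^{−W_K}` and likewise for
  `num_K` (whose observable `Σ_{x,y} cos(θ_x − θ_y)` is `Φ`-invariant after re-indexing);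
* if moreover `K` is purely imaginary, `conj W_K = −W_K` (weights and currents are real), so
  `conj Z_K = ∫ w_J e^{−W_K} = Z_K` and `conj num_K = num_K` (`integral_conj`).
-/

noncomputable section

namespace Summit.HubbardSuperconductivity.HubbardSuperconductivity.Theorems.PerturbedXYOrder

open MeasureTheory Literature.Probability.LatticeModels
open Summit.HubbardSuperconductivity.HubbardSuperconductivity.Theses.NodalWardXY
open scoped ComplexConjugate

variable {L : ℕ}

/-- The torus reflection `R x = (−x₀, x₁, x₂)` (`Function.update x 0 (-x 0)`) squares to the identity. -/
theorem ro_R_R (x : TorusSite 3 L) :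
    Function.update (Function.update x 0 (-x 0)) 0 (-Function.update x 0 (-x 0) 0) = x := by
  funext j
  by_cases hj : j = 0
  · subst hj
    simp
  · simp [hj]

/-- The torus reflection `R` is an involution. -/
theorem ro_R_invol : Function.Involutive (fun x : TorusSite 3 L => Function.update x 0 (-x 0)) :=
  fun x => ro_R_R x

/-- `R (x + e₀) = R x − e₀`. -/
theorem ro_R_add_single_zero (x : TorusSite 3 L) :
    Function.update (x + Pi.single 0 1) 0 (-((x + Pi.single 0 1 : TorusSite 3 L) 0)) =
      Function.update x 0 (-x 0) - Pi.single 0 1 := by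
  funext j
  by_cases hj : j = 0
  · subst hj
    simp
    ring
  · simp [hj]

/-- `R (x + e_i) = R x + e_i` for `i ≠ 0`. -/
theorem ro_R_add_single_ne (x : TorusSite 3 L) {i : Fin 3} (hi : i ≠ 0) :
    Function.update (x + Pi.single i 1) 0 (-((x + Pi.single i 1 : TorusSite 3 L) 0)) =
      Function.update x 0 (-x 0) + Pi.single i 1 := by
  funext j
  by_cases hj : j = 0
  · subst hj
    simp [hi.symm]
  · simp [hj]

/-- The ferromagnetic bond sum `Σ_{(x,i)} cos(θ_{x+e_i} − θ_x)` is invariant under `θ ↦ θ ∘ R`. -/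
theorem ro_bondSum_comp_R [NeZero L] (θ : TorusSite 3 L → ℝ) :
    ∑ b : Bond L, Real.cos
        (θ (Function.update (b.1 + Pi.single b.2 1) 0 (-((b.1 + Pi.single b.2 1 : TorusSite 3 L) 0))) -
          θ (Function.update b.1 0 (-b.1 0))) =
      ∑ b : Bond L, Real.cos (θ (b.1 + Pi.single b.2 1) - θ b.1) := by
  rw [Fintype.sum_prod_type_right, Fintype.sum_prod_type_right]
  refine Finset.sum_congr rfl fun i _ => ?_
  dsimp only
  rcases eq_or_ne i 0 with rfl | hi
  · -- direction `0`: re-index by `x ↦ R x − e₀`; the reflected bond is traversed backwards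
    refine Fintype.sum_bijective
      (fun x : TorusSite 3 L => Function.update x 0 (-x 0) - Pi.single 0 1)
      ((Equiv.subRight _).bijective.comp ro_R_invol.bijective) _ _ fun x => ?_
    show Real.cos
          (θ (Function.update (x + Pi.single 0 1) 0 (-((x + Pi.single 0 1 : TorusSite 3 L) 0))) -
            θ (Function.update x 0 (-x 0))) =
        Real.cos (θ (Function.update x 0 (-x 0) - Pi.single 0 1 + Pi.single 0 1) -
          θ (Function.update x 0 (-x 0) - Pi.single 0 1))
    rw [sub_add_cancel, ro_R_add_single_zero, ← Real.cos_neg, neg_sub]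
  · -- directions `i ≠ 0`: re-index by `x ↦ R x`
    refine Fintype.sum_bijective _ ro_R_invol.bijective _ _ fun x => ?_
    show Real.cos
          (θ (Function.update (x + Pi.single i 1) 0 (-((x + Pi.single i 1 : TorusSite 3 L) 0))) -
            θ (Function.update x 0 (-x 0))) =
        Real.cos (θ (Function.update x 0 (-x 0) + Pi.single i 1) - θ (Function.update x 0 (-x 0)))
    rw [ro_R_add_single_ne x hi]

/-- The ferromagnetic weight is reflection invariant: `w_J (θ ∘ R) = w_J θ`. -/
theorem ro_wJ_comp_R [NeZero L] (J : ℝ) (θ : TorusSite 3 L → ℝ) :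
    wJ J (fun x => θ (Function.update x 0 (-x 0))) = wJ J θ := by
  unfold wJ
  rw [ro_bondSum_comp_R θ]

/-- Change of variables `θ ↦ θ ∘ R` in integrals over the cube `[0, 2π]^Λ`: the coordinate
permutation preserves Lebesgue measure and the cube. -/
theorem ro_setIntegral_comp_R [NeZero L] (g : (TorusSite 3 L → ℝ) → ℂ) :
    ∫ θ in cube L, g (fun x => θ (Function.update x 0 (-x 0))) = ∫ θ in cube L, g θ := by
  set e : Equiv.Perm (TorusSite 3 L) := ro_R_invol.toPerm _
  have hpres : MeasurePreserving (MeasurableEquiv.arrowCongr' e (MeasurableEquiv.refl ℝ))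
      (volume : Measure (TorusSite 3 L → ℝ)) volume :=
    volume_preserving_arrowCongr' e (MeasurableEquiv.refl ℝ) (MeasurePreserving.id volume)
  have hΦ : ∀ θ : TorusSite 3 L → ℝ, (MeasurableEquiv.arrowCongr' e (MeasurableEquiv.refl ℝ)) θ =
      fun x => θ (Function.update x 0 (-x 0)) :=
    fun θ => rfl
  have hcube : (MeasurableEquiv.arrowCongr' e (MeasurableEquiv.refl ℝ)) ⁻¹' cube L = cube L := by
    ext θ
    simp only [Set.mem_preimage, hΦ, cube, Set.mem_univ_pi]
    refine ⟨fun h x => ?_, fun h x => h _⟩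
    have hx := h (Function.update x 0 (-x 0))
    rwa [ro_R_R x] at hx
  have key := hpres.setIntegral_preimage_emb
    (MeasurableEquiv.arrowCongr' e (MeasurableEquiv.refl ℝ)).measurableEmbedding g (cube L)
  rw [hcube] at key
  simpa only [hΦ] using key

/-- For a purely imaginary kernel the perturbation is anti-invariant under conjugation:
`conj W_K = −W_K` (the currents are real). -/
theorem ro_conj_Wk [NeZero L] (K : Bond L → Bond L → ℂ) (hIm : ∀ b b', (K b b').re = 0)
    (θ : TorusSite 3 L → ℝ) : conj (Wk K θ) = -Wk K θ := by
  have hK : ∀ b b', conj (K b b') = -K b b' := fun b b' =>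
    Complex.ext (by simp [hIm b b']) (by simp)
  unfold Wk
  simp only [map_sum, map_mul, Complex.conj_ofReal, hK, neg_mul, Finset.sum_neg_distrib]

/-- The ferromagnetic weight is real: `conj w_J = w_J`. -/
theorem ro_conj_wJ [NeZero L] (J : ℝ) (θ : TorusSite 3 L → ℝ) : conj (wJ J θ) = wJ J θ := by
  unfold wJ
  exact Complex.conj_ofReal _

/-- Conjugating the Gibbs integrand flips the sign of a purely imaginary perturbation. -/
theorem ro_conj_integrand [NeZero L] (J : ℝ) (K : Bond L → Bond L → ℂ)
    (hIm : ∀ b b', (K b b').re = 0) (θ : TorusSite 3 L → ℝ) :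
    conj (wJ J θ * Complex.exp (Wk K θ)) = wJ J θ * Complex.exp (-Wk K θ) := by
  rw [map_mul, ro_conj_wJ, ← Complex.exp_conj, ro_conj_Wk K hIm]

/-- **Reflection-odd imaginary kernels have real partition function and real numerator.**
Let `R` be the reflection `x ↦ (−x₀, x₁, x₂)` of the torus `(ℤ/Lℤ)³` (`Function.update x 0 (-x 0)`).
If `K` is purely imaginary and `W_K` is odd under `θ ↦ θ ∘ R`, then `Z_K` and `num_K` are REAL: the
measure `w_J dθ` on the cube and the observable `Σ_{x,y} cos(θ_x − θ_y)` are invariant under the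
coordinate permutation `θ ↦ θ ∘ R`, so `Z_K = ∫ w_J e^{−W_K}`, while `conj Z_K = ∫ w_J e^{−W_K}` because
the weight and the currents are real; likewise for `num_K`. -/
theorem stub_reflectionOddReal (L : ℕ) [NeZero L] (J : ℝ) (K : Bond L → Bond L → ℂ)
    (hIm : ∀ b b', (K b b').re = 0)
    (hOdd : ∀ θ : TorusSite 3 L → ℝ, Wk K (fun x => θ (Function.update x 0 (-x 0))) = -Wk K θ) :
    (Zk J K).im = 0 ∧ (num J K).im = 0 := by
  constructor
  · rw [← Complex.conj_eq_iff_im]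
    have h1 : conj (Zk J K) = ∫ θ in cube L, wJ J θ * Complex.exp (-Wk K θ) := by
      unfold Zk
      rw [← integral_conj]
      congr 1
      funext θ
      exact ro_conj_integrand J K hIm θ
    have h2 : Zk J K = ∫ θ in cube L, wJ J θ * Complex.exp (-Wk K θ) := by
      unfold Zk
      calc (∫ θ in cube L, wJ J θ * Complex.exp (Wk K θ))
          = ∫ θ in cube L, wJ J (fun x => θ (Function.update x 0 (-x 0))) *
              Complex.exp (Wk K (fun x => θ (Function.update x 0 (-x 0)))) :=
            (ro_setIntegral_comp_R (fun θ => wJ J θ * Complex.exp (Wk K θ))).symm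
        _ = ∫ θ in cube L, wJ J θ * Complex.exp (-Wk K θ) := by
            congr 1
            funext θ
            rw [ro_wJ_comp_R J θ, hOdd θ]
    exact h1.trans h2.symm
  · rw [← Complex.conj_eq_iff_im]
    have h1 : conj (num J K) = ∑ x : TorusSite 3 L, ∑ y : TorusSite 3 L,
        ∫ θ in cube L, (Real.cos (θ x - θ y) : ℂ) * (wJ J θ * Complex.exp (-Wk K θ)) := by
      unfold num
      rw [map_sum]
      refine Finset.sum_congr rfl fun x _ => ?_
      rw [map_sum]
      refine Finset.sum_congr rfl fun y _ => ?_
      rw [← integral_conj]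
      congr 1
      funext θ
      rw [map_mul, Complex.conj_ofReal, ro_conj_integrand J K hIm θ]
    have h2 : num J K = ∑ x : TorusSite 3 L, ∑ y : TorusSite 3 L,
        ∫ θ in cube L, (Real.cos (θ x - θ y) : ℂ) * (wJ J θ * Complex.exp (-Wk K θ)) := by
      unfold num
      -- change variables `θ ↦ θ ∘ R` inside each `(x, y)` integral
      have ha : ∀ x y : TorusSite 3 L,
          (∫ θ in cube L, (Real.cos (θ x - θ y) : ℂ) * (wJ J θ * Complex.exp (Wk K θ))) =
            ∫ θ in cube L,
              (Real.cos (θ (Function.update x 0 (-x 0)) - θ (Function.update y 0 (-y 0))) : ℂ) *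
                (wJ J θ * Complex.exp (-Wk K θ)) := by
        intro x y
        calc (∫ θ in cube L, (Real.cos (θ x - θ y) : ℂ) * (wJ J θ * Complex.exp (Wk K θ)))
            = ∫ θ in cube L,
                (Real.cos (θ (Function.update x 0 (-x 0)) - θ (Function.update y 0 (-y 0))) : ℂ) *
                  (wJ J (fun z => θ (Function.update z 0 (-z 0))) *
                    Complex.exp (Wk K (fun z => θ (Function.update z 0 (-z 0))))) :=
              (ro_setIntegral_comp_R
                (fun θ => (Real.cos (θ x - θ y) : ℂ) * (wJ J θ * Complex.exp (Wk K θ)))).symm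
          _ = _ := by
              congr 1
              funext θ
              rw [ro_wJ_comp_R J θ, hOdd θ]
      simp_rw [ha]
      -- re-index the double site sum by the involution `R`
      calc ∑ x : TorusSite 3 L, ∑ y : TorusSite 3 L, ∫ θ in cube L,
              (Real.cos (θ (Function.update x 0 (-x 0)) - θ (Function.update y 0 (-y 0))) : ℂ) *
                (wJ J θ * Complex.exp (-Wk K θ))
          = ∑ x : TorusSite 3 L, ∑ y : TorusSite 3 L, ∫ θ in cube L,
              (Real.cos (θ x - θ (Function.update y 0 (-y 0))) : ℂ) *
                (wJ J θ * Complex.exp (-Wk K θ)) :=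
            ro_R_invol.bijective.sum_comp (fun x => ∑ y : TorusSite 3 L, ∫ θ in cube L,
              (Real.cos (θ x - θ (Function.update y 0 (-y 0))) : ℂ) *
                (wJ J θ * Complex.exp (-Wk K θ)))
        _ = _ := Finset.sum_congr rfl fun x _ =>
            ro_R_invol.bijective.sum_comp (fun y : TorusSite 3 L =>
              ∫ θ in cube L, (Real.cos (θ x - θ y) : ℂ) * (wJ J θ * Complex.exp (-Wk K θ)))
    exact h1.trans h2.symm

end Summit.HubbardSuperconductivity.HubbardSuperconductivity.Theorems.PerturbedXYOrder

end
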